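import Mathlib
import Literature.AlgebraicGeometry.Resolution.MonomialIdealsRegularParameters
import Literature.AlgebraicGeometry.Resolution.RegularLocalRingsNormal
import Literature.FieldTheory.Separability.FormallySmoothAlgebraic

/-!
# `p`-th powers modulo a monomial from vanishing log-derivatives — elementary lemmas

Helper file for the stub `stub_pthPowerModMonomial` of the line `pfaff-line-log-final-forms`
(crux `Valuative.LuAlphaPTorsor`, item `stmt-ResolutionOfSingularities-0641`).

Setting: `R` a local ring with `p = 0` (`p` prime), `u : Fin d → R` part of a regular system of
parameters (`IsRsopPart u`: `R` is regular local and `u` extends to a minimal basis of `𝔪`),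
and `D : Fin d → Der_ℤ(R)` a family of derivations DUAL to `u` (`D_i u_j = δ_ij`). A derivation
`δ` is *logarithmic* (along all of `u`) when `δ u_i ∈ (u_i)` for every `i`; for an exponent
vector `N` we write `u^N = ∏ u_i^{N_i}` (`CossartPiltant.uPow`).

* `isUnit_natCast_of_not_dvd`, `derivation_apply_pow_eq_zero` — characteristic `p` facts.
* `derivation_uPow_mem`, `derivation_mem_span_uPow` — log derivations preserve `(u^N)`.
* `smul_dual_log`, `self_mul_dual_uPow`, `smul_dual_apply_uPow_mul` — the log derivations
  `u_i D_i` and Euler's identity `u_i D_i (u^N b) = u^N (N_i b + u_i D_i b)`.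
* `mem_span_of_pow_mul_mem` — `u_{i₁}` is a non-zero-divisor modulo `(u_{i₀})` (hypothesis (H)
  of the tree's monomial-ideal file, Matsumura 17.8).
* `exists_eq_pow_mul_add` — **the key congruence**: if `p ∤ m`, `i₁ ≠ i₀` and
  `m b + u_{i₁} D_{i₁} b ∈ (u_{i₀})`, then `b ∈ (u_{i₁}^t) + (u_{i₀})` with `p ∣ m + t`.
* `uPow_mul_self_mem`, `uPow_mul_mem_iff` — `u^N u_{i₀} ∈ (u^M)` and the colon formula
  `((u^M) : u^N) = (u_{i₀})` when `M - N = e_{i₀}` (Cossart–Piltant Prop. 2.1 machinery).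

The induction itself is `ValuativeLuAlphaPTorsorPthPowerModMonomialInduction.lean`. The
`ℤ`-algebra structure of `R` is a section variable (localizations carry their own instance).
-/

set_option linter.dupNamespace false

namespace Summit.ResolutionOfSingularities.ResolutionOfSingularities.Theorems.PfaffLine

open IsLocalRing Literature.AlgebraicGeometry.Resolution
open Literature.AlgebraicGeometry.Resolution.CossartPiltant (uPow uPow_add uPow_zero uPow_single
  uPow_dvd_uPow_of_le)

universe u

variable {R : Type u} [CommRing R]

/-! ## Elementary facts: characteristic `p`, derivations, monomials -/

/-- In a ring with `p = 0` (`p` prime) a natural number prime to `p` is a unit. [folklore] -/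
theorem isUnit_natCast_of_not_dvd [Nontrivial R] {p : ℕ} (hp : p.Prime) (hpR : (p : R) = 0)
    {m : ℕ} (hm : ¬ p ∣ m) : IsUnit (m : R) := by
  haveI : CharP R p := (CharP.charP_iff_prime_eq_zero hp).mpr hpR
  have hcop : m.Coprime p := (Nat.Prime.coprime_iff_not_dvd hp).mpr hm |>.symm
  have h := (ZMod.unitOfCoprime m hcop).isUnit
  rw [ZMod.coe_unitOfCoprime] at h
  have := h.map (ZMod.castHom (dvd_refl p) R)
  rwa [map_natCast] at this

variable [Algebra ℤ R]

/-- **Logarithmic derivative of a monomial.** If `δ u_i = e_i u_i` for `i ∈ E`, then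
`δ (∏_{i∈E} u_i^{M_i}) = (∑_{i∈E} M_i e_i) · ∏_{i∈E} u_i^{M_i}`. [folklore] -/
-- adapted from Theorems/ValuativeLuAlphaPTorsorFinalFormExits.lean (`derivation_prod_pow_eq_sum_mul`)
theorem derivation_prod_pow_eq_sum_mul_prod (δ : Derivation ℤ R R) {ι : Type*} [DecidableEq ι]
    (E : Finset ι) (u : ι → R) (M : ι → ℕ) (e : ι → R) (he : ∀ i ∈ E, δ (u i) = e i * u i) :
    δ (E.prod fun i => u i ^ M i) =
      (E.sum fun i => (M i : R) * e i) * E.prod fun i => u i ^ M i := by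
  induction E using Finset.induction_on with
  | empty => simp
  | insert j E hj ih =>
    have hE : ∀ i ∈ E, δ (u i) = e i * u i := fun i hi => he i (Finset.mem_insert_of_mem hi)
    rw [Finset.prod_insert hj, Finset.sum_insert hj, Derivation.leibniz, Derivation.leibniz_pow,
      ih hE, he j (Finset.mem_insert_self j E), smul_eq_mul, smul_eq_mul, nsmul_eq_mul]
    rcases Nat.eq_zero_or_pos (M j) with h0 | hpos
    · rw [h0]
      ring
    · obtain ⟨n, hn⟩ := Nat.exists_eq_add_one_of_ne_zero hpos.ne'
      rw [hn, Nat.add_sub_cancel]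
      push_cast
      ring

/-- Derivations kill `p`-th powers when `p = 0`. [folklore] -/
theorem derivation_apply_pow_eq_zero {p : ℕ} (hpR : (p : R) = 0) (δ : Derivation ℤ R R) (c : R) :
    δ (c ^ p) = 0 := by
  rw [Derivation.leibniz_pow, nsmul_eq_mul, hpR, zero_mul]

/-- A logarithmic derivation maps a monomial into the ideal it generates. [folklore] -/
theorem derivation_uPow_mem {d : ℕ} (u : Fin d → R) (δ : Derivation ℤ R R)
    (hlog : ∀ i, δ (u i) ∈ Ideal.span {u i}) (N : Fin d → ℕ) :
    δ (uPow u N) ∈ Ideal.span {uPow u N} := by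
  classical
  choose e he using fun i => Ideal.mem_span_singleton'.mp (hlog i)
  have h := derivation_prod_pow_eq_sum_mul_prod δ Finset.univ u N e fun i _ => (he i).symm
  change δ (∏ j, u j ^ N j) ∈ Ideal.span {∏ j, u j ^ N j}
  rw [h]
  exact Ideal.mul_mem_left _ _ (Ideal.mem_span_singleton_self _)

/-- A logarithmic derivation preserves every monomial ideal `(u^N)`. [folklore] -/
theorem derivation_mem_span_uPow {d : ℕ} (u : Fin d → R) (δ : Derivation ℤ R R)
    (hlog : ∀ i, δ (u i) ∈ Ideal.span {u i}) (N : Fin d → ℕ) {x : R}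
    (hx : x ∈ Ideal.span {uPow u N}) : δ x ∈ Ideal.span {uPow u N} := by
  obtain ⟨r, rfl⟩ := Ideal.mem_span_singleton'.mp hx
  rw [Derivation.leibniz, smul_eq_mul, smul_eq_mul]
  exact Ideal.add_mem _ (Ideal.mul_mem_left _ _ (derivation_uPow_mem u δ hlog N))
    (Ideal.mul_mem_right _ _ (Ideal.mem_span_singleton_self _))

section Dual

variable {d : ℕ} (u : Fin d → R) (D : Fin d → Derivation ℤ R R)
  (hD : ∀ i j, D i (u j) = if i = j then 1 else 0)

include hD

/-- `u_i D_i` is logarithmic. [folklore] -/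
theorem smul_dual_log (i j : Fin d) : (u i • D i) (u j) ∈ Ideal.span {u j} := by
  rw [Derivation.smul_apply, smul_eq_mul, hD]
  by_cases hij : i = j
  · subst hij
    rw [if_pos rfl, mul_one]
    exact Ideal.mem_span_singleton_self _
  · rw [if_neg hij, mul_zero]
    exact zero_mem _

/-- `u_i D_i (u_i^j) = j u_i^j`. [folklore] -/
theorem self_mul_dual_pow (i : Fin d) (j : ℕ) : u i * D i (u i ^ j) = j * u i ^ j := by
  rw [Derivation.leibniz_pow, hD, if_pos rfl, smul_eq_mul, mul_one, nsmul_eq_mul]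
  rcases Nat.eq_zero_or_pos j with rfl | hj
  · simp
  · obtain ⟨n, rfl⟩ := Nat.exists_eq_add_one_of_ne_zero hj.ne'
    rw [Nat.add_sub_cancel, pow_succ]
    ring

/-- **Euler's identity for the dual derivations**: `u_i D_i (u^N) = N_i u^N`. [folklore] -/
theorem self_mul_dual_uPow (i : Fin d) (N : Fin d → ℕ) :
    u i * D i (uPow u N) = N i * uPow u N := by
  classical
  have h := derivation_prod_pow_eq_sum_mul_prod (u i • D i) Finset.univ u N
    (fun j => if i = j then 1 else 0) fun j _ => by
      rw [Derivation.smul_apply, smul_eq_mul, hD]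
      by_cases hij : i = j
      · subst hij; simp
      · simp [hij]
  rw [Derivation.smul_apply, smul_eq_mul] at h
  simp only [mul_ite, mul_one, mul_zero, Finset.sum_ite_eq, Finset.mem_univ, if_true] at h
  exact h

/-- `u_i D_i (u^N b) = u^N (N_i b + u_i D_i b)`. [folklore] -/
theorem smul_dual_apply_uPow_mul (i : Fin d) (N : Fin d → ℕ) (b : R) :
    (u i • D i) (uPow u N * b) = uPow u N * (N i * b + u i * D i b) := by
  have h := self_mul_dual_uPow u D hD i N
  rw [Derivation.smul_apply, smul_eq_mul, Derivation.leibniz, smul_eq_mul, smul_eq_mul]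
  linear_combination b * h

end Dual


/-! ## The induction -/

section Induction

variable [IsLocalRing R] {p : ℕ} {d : ℕ} {u : Fin d → R}

omit [Algebra ℤ R] in
/-- (H) iterated: for `i₁ ≠ i₀`, `u_{i₁}^j y ∈ (u_{i₀}) ⟹ y ∈ (u_{i₀})`. [folklore] -/
theorem mem_span_of_pow_mul_mem (hu : IsRsopPart u) {i₀ i₁ : Fin d} (h : i₁ ≠ i₀) (j : ℕ)
    {y : R} (hy : u i₁ ^ j * y ∈ Ideal.span {u i₀}) : y ∈ Ideal.span {u i₀} := by
  classical
  have key : ∀ z, u i₁ * z ∈ Ideal.span {u i₀} → z ∈ Ideal.span {u i₀} := by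
    intro z hz
    have h1 := hu.mem_span_image_of_mul_mem i₁ {i₀} (by simpa using h) z
    rw [Finset.coe_singleton, Set.image_singleton] at h1
    exact h1 hz
  induction j generalizing y with
  | zero => simpa using hy
  | succ j ih =>
    refine ih (key _ ?_)
    have : u i₁ * (u i₁ ^ j * y) = u i₁ ^ (j + 1) * y := by ring
    rwa [this]

/-- **The key congruence.** If `p ∤ m`, `i₁ ≠ i₀` and `m b + u_{i₁} D_{i₁} b ∈ (u_{i₀})`, then
`b ∈ (u_{i₁}^t) + (u_{i₀})` for some `t` with `p ∣ m + t` (iterate: modulo `u_{i₀}`,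
`(m + j) b_j ≡ -u_{i₁} D_{i₁} b_j`, and `m + j` is a unit while `p ∤ m + j`). [folklore] -/
theorem exists_eq_pow_mul_add (hp : p.Prime) (hpR : (p : R) = 0) (hu : IsRsopPart u)
    (D : Fin d → Derivation ℤ R R) (hD : ∀ i j, D i (u j) = if i = j then 1 else 0)
    {i₀ i₁ : Fin d} (h01 : i₁ ≠ i₀) {m : ℕ} (hm : ¬ p ∣ m) {b : R}
    (hb : (m : R) * b + u i₁ * D i₁ b ∈ Ideal.span {u i₀}) :
    ∃ (t : ℕ) (b₀ g : R), p ∣ m + t ∧ b = u i₁ ^ t * b₀ + u i₀ * g := by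
  have hp0 : 0 < p := hp.pos
  have hmod : m % p ≠ 0 := fun h => hm (Nat.dvd_of_mod_eq_zero h)
  have hmlt : m % p < p := Nat.mod_lt m hp0
  set t₀ := p - m % p with ht₀
  have hdm := Nat.div_add_mod m p
  have hdiv : p ∣ m + t₀ := by
    refine ⟨m / p + 1, ?_⟩
    rw [mul_add, mul_one]
    generalize p * (m / p) = q at hdm ⊢
    omega
  have hndiv : ∀ j, j < t₀ → ¬ p ∣ m + j := by
    intro j hj hdvd
    have h1 : (m + j) % p = 0 := Nat.eq_zero_of_dvd_of_lt hdvd |> fun h => ?_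
    · rw [Nat.add_mod, Nat.mod_eq_of_lt (show j < p by omega),
        Nat.mod_eq_of_lt (show m % p + j < p by omega)] at h1
      omega
    · exact Nat.mod_eq_zero_of_dvd hdvd
  have hD10 : D i₁ (u i₀) = 0 := by rw [hD, if_neg h01]
  have claim : ∀ j, j ≤ t₀ → ∃ bj g : R, b = u i₁ ^ j * bj + u i₀ * g := by
    intro j
    induction j with
    | zero => exact fun _ => ⟨b, 0, by ring⟩
    | succ j ih =>
      intro hj
      obtain ⟨bj, g, hbg⟩ := ih (Nat.le_of_succ_le hj)
      have hjlt : j < t₀ := hj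
      have hunit : IsUnit ((m + j : ℕ) : R) := isUnit_natCast_of_not_dvd hp hpR (hndiv j hjlt)
      have hpow := self_mul_dual_pow u D hD i₁ j
      have hcalc : (m : R) * b + u i₁ * D i₁ b =
          u i₁ ^ j * (((m + j : ℕ) : R) * bj + u i₁ * D i₁ bj) +
            u i₀ * ((m : R) * g + u i₁ * D i₁ g) := by
        rw [hbg]
        simp only [map_add, Derivation.leibniz, smul_eq_mul, hD10, mul_zero, add_zero]
        push_cast
        linear_combination bj * hpow
      -- `(m + j) bj + u_{i₁} D bj ∈ (u_{i₀})`
      have hX : ((m + j : ℕ) : R) * bj + u i₁ * D i₁ bj ∈ Ideal.span {u i₀} := by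
        refine mem_span_of_pow_mul_mem hu h01 j ?_
        have h2 : u i₁ ^ j * (((m + j : ℕ) : R) * bj + u i₁ * D i₁ bj) =
            ((m : R) * b + u i₁ * D i₁ b) - u i₀ * ((m : R) * g + u i₁ * D i₁ g) := by
          rw [hcalc]; ring
        rw [h2]
        exact Ideal.sub_mem _ hb (Ideal.mul_mem_right _ _ (Ideal.mem_span_singleton_self _))
      -- hence `bj ∈ (u_{i₀}) + (u_{i₁})`
      have hbj : bj ∈ Ideal.span {u i₀} ⊔ Ideal.span {u i₁} := by
        have h3 : ((m + j : ℕ) : R) * bj ∈ Ideal.span {u i₀} ⊔ Ideal.span {u i₁} := by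
          have : ((m + j : ℕ) : R) * bj =
              (((m + j : ℕ) : R) * bj + u i₁ * D i₁ bj) - u i₁ * D i₁ bj := by ring
          rw [this]
          exact Ideal.sub_mem _ (Ideal.mem_sup_left hX)
            (Ideal.mem_sup_right (Ideal.mul_mem_right _ _ (Ideal.mem_span_singleton_self _)))
        obtain ⟨v, hv⟩ := hunit
        have : bj = (↑v⁻¹ : R) * (((m + j : ℕ) : R) * bj) := by
          rw [← hv, ← mul_assoc, Units.inv_mul, one_mul]
        rw [this]
        exact Ideal.mul_mem_left _ _ h3
      obtain ⟨y, hy, z, hz, hyz⟩ := Submodule.mem_sup.mp hbj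
      obtain ⟨g', rfl⟩ := Ideal.mem_span_singleton'.mp hy
      obtain ⟨b', rfl⟩ := Ideal.mem_span_singleton'.mp hz
      refine ⟨b', u i₁ ^ j * g' + g, ?_⟩
      rw [hbg, ← hyz]
      ring
  obtain ⟨b₀, g, h⟩ := claim t₀ le_rfl
  exact ⟨t₀, b₀, g, hdiv, h⟩

omit [Algebra ℤ R] [IsLocalRing R] in
/-- `u^N u_{i₀} ∈ (u^M)` when `M ≤ N + e_{i₀}`. [folklore] -/
theorem uPow_mul_self_mem {M N : Fin d → ℕ} {i₀ : Fin d} (hN₀ : N i₀ + 1 = M i₀)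
    (hMN : ∀ i, i ≠ i₀ → M i ≤ N i) : uPow u N * u i₀ ∈ Ideal.span {uPow u M} := by
  rw [← uPow_single u i₀, ← uPow_add]
  refine Ideal.mem_span_singleton.mpr (uPow_dvd_uPow_of_le u fun i => ?_)
  by_cases hi : i = i₀
  · subst hi; simp only [Pi.add_apply, Pi.single_eq_same]; omega
  · rw [Pi.add_apply, Pi.single_eq_of_ne hi, add_zero]; exact hMN i hi

variable (hu : IsRsopPart u) {M N : Fin d → ℕ} {i₀ : Fin d} (hN₀ : N i₀ + 1 = M i₀)
  (hMN : ∀ i, i ≠ i₀ → M i ≤ N i)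

include hu hN₀ hMN

omit [Algebra ℤ R] in
/-- The colon formula `((u^M) : u^N) = (u_{i₀})` when `M - N = e_{i₀}`. [folklore] -/
theorem uPow_mul_mem_iff (y : R) :
    uPow u N * y ∈ Ideal.span {uPow u M} ↔ y ∈ Ideal.span {u i₀} := by
  have h := hu.uPow_mul_mem_span_uPow_iff {M} N (y := y)
  rw [Set.image_singleton, Set.image_singleton] at h
  have hMN' : M - N = Pi.single i₀ 1 := by
    funext i
    by_cases hi : i = i₀
    · subst hi; simp only [Pi.sub_apply, Pi.single_eq_same]; omega
    · rw [Pi.sub_apply, Pi.single_eq_of_ne hi]; exact Nat.sub_eq_zero_of_le (hMN i hi)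
  rw [hMN'] at h
  simpa only [Set.image_singleton, uPow_single] using h

end Induction

/-- **Registered sub-goal `pthPowerModMonomial_key_congruence`** (closed form of
`exists_eq_pow_mul_add`, for `--supports` registration): the characteristic-`p` congruence
`m b + u_{i₁} D_{i₁} b ∈ (u_{i₀})`, `p ∤ m` `⟹` `b ∈ (u_{i₁}^t) + (u_{i₀})` with `p ∣ m + t`.
[folklore] -/
theorem pthPowerModMonomial_key_congruence : ∀ {R : Type*} [CommRing R] [Algebra ℤ R] [IsLocalRing R] {p d : ℕ} {u : Fin d → R}, p.Prime → (p : R) = 0 → Literature.AlgebraicGeometry.Resolution.IsRsopPart u → ∀ (D : Fin d → Derivation ℤ R R), (∀ i j, D i (u j) = if i = j then 1 else 0) → ∀ {i₀ i₁ : Fin d}, i₁ ≠ i₀ → ∀ {m : ℕ}, ¬ p ∣ m → ∀ {b : R}, (m : R) * b + u i₁ * D i₁ b ∈ Ideal.span {u i₀} → ∃ (t : ℕ) (b₀ g : R), p ∣ m + t ∧ b = u i₁ ^ t * b₀ + u i₀ * g :=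
  fun hp hpR hu D hD _ _ h01 _ hm _ hb => exists_eq_pow_mul_add hp hpR hu D hD h01 hm hb

end Summit.ResolutionOfSingularities.ResolutionOfSingularities.Theorems.PfaffLine
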